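import Mathlib
import Summits.Ventures.HodgeRepro2.T5ComponentSum
import Summits.Ventures.HodgeRepro2.T5ComponentIdentity
import Summits.Ventures.HodgeRepro2.T5TwoZeroPositivity

/-!
# T5PeriodSupport — a non-zero period forces both forms to be non-zero on one component

Tier-5 support for sub-step N1 (Hodge-theoretic side; memo route/T5-N1-hodge-p6.md §H5–H7):
the memo remarks (H7.3) that «`ω_{ab} ≠ 0` … is implied by the conclusion `ℓ_A^σ ≢ 0` … `ω_{ab}`
pairs non-trivially, so in particular `ω_{ab} ≠ 0`», and argues on a component `S_j`.  In the
coframe model (`α = a dz₁∧dz₂`, `β = b dz₁∧dz₂`, `∫_S α ∧ β̄ = 4 ∫_S a b̄ dVol_S`) this is the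
composition of three earlier files:

* `exists_component_ne_zero_of_integral_ne_zero`: if `∫_S α ∧ β̄ ≠ 0` then at some point of some
  component BOTH coefficients are non-zero (`T5ComponentSum.exists_setIntegral_ne_zero` and the
  vanishing of a set integral with vanishing integrand);
* `exists_component_dense_of_integral_ne_zero`: if moreover `a`, `b` are holomorphic in every chart,
  then on that component each of `{a ≠ 0}`, `{b ≠ 0}` is dense (the identity principle on the
  component, `T5ComponentIdentity.exists_ne_zero_iff_subset_closure`);
* `integral_eq_zero_of_forall_component_eq_zero`: conversely, if on every component one of the
  two forms vanishes identically, the period is `0`.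

Blind lane (cell pub-hodge-repro2): `import Mathlib` + own files, 0 sorry, standard axioms.
-/

namespace Summit.Ventures.HodgeRepro2.T5PeriodSupport

open MeasureTheory Set
open Summit.Ventures.HodgeRepro2.T5ComponentSum Summit.Ventures.HodgeRepro2.T5ComponentIdentity
open Summit.Ventures.HodgeRepro2.T5HodgeStar Summit.Ventures.HodgeRepro2.T5TwoZeroPositivity

variable {S : Type*} [TopologicalSpace S] [LocallyConnectedSpace S] [MeasurableSpace S]
  [OpensMeasurableSpace S] {μ : Measure S} [Fintype (ConnectedComponents S)]

/-- The integrand `α_s ∧ β̄_s = 4 a(s) b̄(s) Vol` vanishes at `s` iff `a s = 0` or `b s = 0`. -/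
theorem wedge_eq_zero_iff (a b : ℂ) :
    wedge (twoZero a) (conjC (twoZero b)) = 0 ↔ a = 0 ∨ b = 0 := by
  rw [wedge_twoZero_conjC, mul_eq_zero, mul_eq_zero, map_eq_zero]
  constructor
  · rintro ((h4 | ha) | hb)
    · exact absurd h4 (by norm_num)
    · exact Or.inl ha
    · exact Or.inr hb
  · rintro (ha | hb)
    · exact Or.inl (Or.inr ha)
    · exact Or.inr hb

/-- If the period `∫_S α ∧ β̄` is non-zero, then on some connected component there is a point where
both coefficients `a`, `b` are non-zero. -/
theorem exists_component_ne_zero_of_integral_ne_zero {a b : S → ℂ}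
    (hab : Integrable (fun s => wedge (twoZero (a s)) (conjC (twoZero (b s)))) μ)
    (h : ∫ s, wedge (twoZero (a s)) (conjC (twoZero (b s))) ∂μ ≠ 0) :
    ∃ c : ConnectedComponents S, ∃ s ∈ component c, a s ≠ 0 ∧ b s ≠ 0 := by
  obtain ⟨c, hc⟩ := exists_setIntegral_ne_zero hab h
  refine ⟨c, ?_⟩
  by_contra hcon
  simp only [not_exists, not_and, not_not] at hcon
  refine hc (setIntegral_eq_zero_of_forall_eq_zero fun s hs => ?_)
  rw [wedge_eq_zero_iff]
  by_cases ha : a s = 0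
  · exact Or.inl ha
  · exact Or.inr (hcon s hs ha)

/-- Conversely: if on every component one of the two forms vanishes identically, the period is
zero. -/
theorem integral_eq_zero_of_forall_component_eq_zero {a b : S → ℂ}
    (hab : Integrable (fun s => wedge (twoZero (a s)) (conjC (twoZero (b s)))) μ)
    (h : ∀ c : ConnectedComponents S, (∀ s ∈ component c, a s = 0) ∨ ∀ s ∈ component c, b s = 0) :
    ∫ s, wedge (twoZero (a s)) (conjC (twoZero (b s))) ∂μ = 0 := by
  refine integral_eq_zero_of_forall_component hab fun c => ?_
  refine setIntegral_eq_zero_of_forall_eq_zero fun s hs => ?_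
  rw [wedge_eq_zero_iff]
  rcases h c with ha | hb
  · exact Or.inl (ha s hs)
  · exact Or.inr (hb s hs)

section Charts

variable {E : Type*} [NormedAddCommGroup E] [NormedSpace ℂ E] [NormedSpace ℝ E] [ChartedSpace E S]

/-- If the period is non-zero and the coefficients `a`, `b` are holomorphic in every chart, then on
some component `S_j` both `{a ≠ 0}` and `{b ≠ 0}` are dense in `S_j` (identity principle on the
component). -/
theorem exists_component_dense_of_integral_ne_zero {a b : S → ℂ}
    (ha : ∀ x : S, AnalyticOnNhd ℂ (a ∘ (chartAt E x).symm) (chartAt E x).target)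
    (hb : ∀ x : S, AnalyticOnNhd ℂ (b ∘ (chartAt E x).symm) (chartAt E x).target)
    (hab : Integrable (fun s => wedge (twoZero (a s)) (conjC (twoZero (b s)))) μ)
    (h : ∫ s, wedge (twoZero (a s)) (conjC (twoZero (b s))) ∂μ ≠ 0) :
    ∃ c : ConnectedComponents S,
      component c ⊆ closure (component c ∩ {s | a s ≠ 0}) ∧
        component c ⊆ closure (component c ∩ {s | b s ≠ 0}) := by
  obtain ⟨c, s, hs, has, hbs⟩ := exists_component_ne_zero_of_integral_ne_zero hab h
  exact ⟨c, (exists_ne_zero_iff_subset_closure (E := E) ha c).mp ⟨s, hs, has⟩,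
    (exists_ne_zero_iff_subset_closure (E := E) hb c).mp ⟨s, hs, hbs⟩⟩

end Charts

end Summit.Ventures.HodgeRepro2.T5PeriodSupport
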